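import Mathlib
import Summits.ValiantsHypothesis.ValiantsHypothesis.Theorems.KPlusLogSqLawWeakLiftingTowerGraftFoldLawAxisPair

/-!
# Tower graft line — THE COMPLETED SQUARE OF THE RANK-TWO INDEFINITE GRAFT: `4·det G·det(G + c(Eᵢᵢ − Eⱼⱼ)) = (two corner grafts)² − c²·(fold factors)`

Mechanism file for the line `Cruxes/WeakLifting/Lines/tower_graft.lean` (crux `WeakLifting` = stmt-ValiantsHypothesis-19561); a normal form on top
of p709692 (`…FoldLawAxisPair`).  NO stub is claimed.

For a symmetric `G` over any commutative ring, `i ≠ j`, scalar `c`: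
* `det_add_corner_add_det_sub_corner` — `det(G + c·Eᵢᵢ) + det(G − c·Eⱼⱼ) = 2·det G + c·(adjᵢᵢ − adjⱼⱼ)` (two CORNER grafts, S4b's objects);
* ★ `four_det_mul_det_axisPair_graft` — **`4·det G · det(G + c·(Eᵢᵢ − Eⱼⱼ)) = (det(G + c·Eᵢᵢ) + det(G − c·Eⱼⱼ))² − c²·F₋·F₊`** with
  `F∓ = adj(U±ᵀ G U±)ⱼⱼ` the two FOLD FACTORS of p709692 (`U± = transvection j i (±1)`; class determinants one size down for pencils):
  the rank-two indefinite graft, off the base roots, is the difference of a SQUARE OF A SUM OF TWO RANK-ONE GRAFTS and `c²` times the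
  PRODUCT OF THE TWO COMPRESSIONS — `h = 0 ⟺ |corner sum| = c·√(F₋F₊)` on `{F₋F₊ ≥ 0}`.

READING (research lead, not a claim): at `c = X^D` the rank-one grafts are governed by the tree's residual-determinant law
(`…TowerGraftRankOneGraft.card_posRoots_rankOneGraft_le`: `≤ 2B + B′ + 1` with `B′` the class budget at size `2m+1`), and `F∓` by the class budget
at size `m − 1`; a KPT/Rolle step on `P² − c²F₋F₊` (`P` the corner sum) produces `Ψ₀ + c·Ψ₁` with `Ψ₁ = t·(F₊·W(F₋, adj₊₋) + F₋·W(F₊, adj₊₋))`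
(Wronskians of cofactors) — whether `Ψ₁` is again a class determinant of a tripled pencil (as the rank-one residual is of a doubled one) is the
question that would put the rank-two graft law below a size-multiplication class law (S4d-type).  HONEST FRAMING: an identity; nothing on
S4/S4b/S5/S5ᴸ, TowerB, `WeakLifting`, Conjecture B, `MatrixDescartes` (18050) or `VP ≠ VNP`.  Def-free.  Seat: prover val-sym-lift-p2 g21,
`--supports stmt-ValiantsHypothesis-19561`.
-/

-- `Summit.ValiantsHypothesis.ValiantsHypothesis.…` repeats a component by the D-0017 layout
-- (single-conjunct summit), which the `dupNamespace` linter flags; the name is mandated.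
set_option linter.dupNamespace false

namespace Summit.ValiantsHypothesis.ValiantsHypothesis.Theorems.KPlusLogSqLaw.TowerGraft

open Polynomial Matrix
open scoped BigOperators Polynomial

section CompletedSquare

variable {n : Type*} [Fintype n] [DecidableEq n] {R : Type*} [CommRing R]

/-- **two corner grafts**: `det(G + c·Eᵢᵢ) + det(G − c·Eⱼⱼ) = 2·det G + c·(adjᵢᵢ − adjⱼⱼ)`. [this work] -/
theorem det_add_corner_add_det_sub_corner (G : Matrix n n R) (i j : n) (c : R) :
    (G + c • Matrix.single i i (1 : R)).det + (G - c • Matrix.single j j (1 : R)).det =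
      2 * G.det + c * (G.adjugate i i - G.adjugate j j) := by
  rw [sub_eq_add_neg, ← neg_smul, det_add_smul_single_eq_adjugate, det_add_smul_single_eq_adjugate]
  ring

/-- **THE COMPLETED SQUARE OF THE RANK-TWO INDEFINITE GRAFT** (symmetric `G`):
`4·det G·det(G + c·(Eᵢᵢ − Eⱼⱼ)) = (det(G + c·Eᵢᵢ) + det(G − c·Eⱼⱼ))² − c²·F₋·F₊`, `F∓` the fold factors of p709692. [this work] -/
theorem four_det_mul_det_axisPair_graft {G : Matrix n n R} (hG : G.IsSymm) {i j : n} (hij : i ≠ j) (c : R) :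
    4 * G.det * (G + c • Matrix.single i i (1 : R) - c • Matrix.single j j (1 : R)).det =
      ((G + c • Matrix.single i i (1 : R)).det + (G - c • Matrix.single j j (1 : R)).det) ^ 2 -
        c ^ 2 * (((Matrix.transvection j i (1 : R))ᵀ * G * Matrix.transvection j i (1 : R)).adjugate j j *
          ((Matrix.transvection j i (-1 : R))ᵀ * G * Matrix.transvection j i (-1 : R)).adjugate j j) := by
  rw [det_add_corner_add_det_sub_corner, det_add_smul_single_sub_smul_single G hij, ← foldFactor_sub_eq hG hij,
    ← foldFactor_add_eq hG hij]
  have h := foldDisc_eq_mul hG hij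
  linear_combination (-(c ^ 2)) * h

/-- the same as a root statement over an integral domain: off the zeros of `det G`, the graft vanishes iff the square of the corner sum equals
`c²` times the product of the fold factors. [this work] -/
theorem det_axisPair_graft_eq_zero_iff {S : Type*} [CommRing S] [IsDomain S] {G : Matrix n n S} (hG : G.IsSymm) {i j : n} (hij : i ≠ j)
    (c : S) (h0 : G.det ≠ 0) (h2 : (2 : S) ≠ 0) :
    (G + c • Matrix.single i i (1 : S) - c • Matrix.single j j (1 : S)).det = 0 ↔
      ((G + c • Matrix.single i i (1 : S)).det + (G - c • Matrix.single j j (1 : S)).det) ^ 2 =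
        c ^ 2 * (((Matrix.transvection j i (1 : S))ᵀ * G * Matrix.transvection j i (1 : S)).adjugate j j *
          ((Matrix.transvection j i (-1 : S))ᵀ * G * Matrix.transvection j i (-1 : S)).adjugate j j) := by
  have h := four_det_mul_det_axisPair_graft hG hij c
  have h4 : (4 : S) * G.det ≠ 0 := mul_ne_zero (by
    have : (4 : S) = 2 * 2 := by norm_num
    rw [this]; exact mul_ne_zero h2 h2) h0
  constructor
  · intro hz
    rw [hz, mul_zero] at h
    exact (sub_eq_zero.mp h.symm)
  · intro heq
    have : 4 * G.det * (G + c • Matrix.single i i (1 : S) - c • Matrix.single j j (1 : S)).det = 0 := by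
      rw [h, heq, sub_self]
    rcases mul_eq_zero.mp this with h' | h'
    · exact absurd h' h4
    · exact h'

end CompletedSquare

end Summit.ValiantsHypothesis.ValiantsHypothesis.Theorems.KPlusLogSqLaw.TowerGraft
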